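import Summits.ResolutionOfSingularities.ResolutionOfSingularities.Theorems.HilbertSamuelEliminationSigmaMaxModificationsCorridor3SigmaSurfaceBadnessCureDrop
import Summits.ResolutionOfSingularities.ResolutionOfSingularities.Theorems.HilbertSamuelEliminationSigmaMaxModificationsCorridor3SigmaSurfaceBadnessIso
import Summits.ResolutionOfSingularities.ResolutionOfSingularities.Theorems.HilbertSamuelEliminationSigmaMaxModificationsCorridor3SigmaMenuSurfaceStepNext
import Summits.ResolutionOfSingularities.ResolutionOfSingularities.Theorems.HilbertSamuelEliminationSigmaMaxModificationsCorridor3SigmaBoundaryCoincidence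
import Literature.AlgebraicGeometry.Resolution.IdealSheafDescent
import HarnessLib

/-!
# [OURS · L1 W4.2] σ-LAYER PHASE B′ — `Corridor3SigmaSurfaceBadnessCureNext`: **`M` STRICTLY DROPS AT THE CURE-CURVE STEP OF THE RUN** — under coincidence the
# filtered traces of `E.next C` on the next reduced surface, read on the model `D̃ ≅ D̃_next` (the blow-up of the regular surface along the Cartier curve `c = cl{ζ}`
# is the identity), ARE the cured list `(E.restrictOff ι_D).cureAlong ζ`; hence for a BAD component on an snc configuration (`ℓ(E, D) = 0`) of a surface
# `M(E.next C, surfaceNext (blowup.π C) C D) < M(E, D)` — the `M`-coordinate of `lex(ℓ, M)` at the CURE step (the ℓ-coordinate is unchanged, p550218)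
# (RULING v3.14-43 (KN) (R-a); res-L1-w42-stub-1 DESIGN CHECK 2 (a)(b)(c); carrier law `…SurfaceBadnessCureDrop`, transport `…SurfaceBadnessIso`, res-type-067's member
# laws `…SigmaSurfaceStrictTransform` and coincidence `…SigmaBoundaryCoincidence`; crux chain w42 `SigmaMaxModifications` stmt-ResolutionOfSingularities-18506 /
# conjunct `SigmaMaxModificationsCorridor3` stmt-ResolutionOfSingularities-19249; helper of res-L1-w42-stub-1 (gen 6), `--supports stmt-…-19249 --as helper`, counted 0)

HONEST FRAMING. OURS bookkeeping: the list identity is assembled from res-type-067's `comap_strictTransformHom_controlledTransform` / `comap_strictTransformHom_exceptional`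
(CJS Lemma 4.8 (a) in tree language), `exists_iso_menuCentre_surfaceNext`, `Boundary.restrictOff_map_comap`, the coincidence predicate `Boundary.Coincides` (the
run's member transform IS CJS's principal strict transform — a HYPOTHESIS here, discharged on B-permissible scopes by res-D-pv-060's `…OffMemberCoincidence`),
Literature `IsBlowup.id` (the blow-up along a Cartier divisor is the identity), `comap_vanishingIdeal_image_of_isClosedImmersion`, and this seat's p548141/p550218
support-level core. NOTHING here is a statement of H. Hironaka's manuscript [Hironaka2017] nor of [CossartJannsenSaito2020]; no named fact. AI-written; AI review is
weaker than expert review.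

## Contents (namespace `…Theorems.SigmaMaxModificationsCorridor3.Sigma`)

* `comap_strictTransformHom_memberTransform_eq_cureMember` — member by member: along the comparison `j : D̃ ⟶ W′` (for `ρ = 𝟙`), the transform of a coinciding
  member restricts to the CURED trace.
* **`restrictOff_next_strictTransformHom_eq_cureAlong`** — THE LIST IDENTITY `(E.next C).restrictOff j = (E.restrictOff ι).cureAlong ζ`.
* **`badOfRecord_next_eq_badness_cureAlong`**, **`badOfRecord_next_lt_of_cure`** (bad component, `S(E, D)` snc, `dim D̃ ≤ 2` ⇒ `M` drops) and
  `badOfRecord_next_le_of_cure`.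

VACUITY SELF-CHECK. The hypotheses (irreducible `D`, Noetherian regular `D̃` of dimension `≤ 2`, `E.Coincides C`, centre = the reduced curve `ι(cl{ζ})` on a
codimension-one point `ζ` of the configuration) are those of the B′ cure step of the (P1*) oracle; `E.Coincides C` holds e.g. for `E = []` and is the run invariant of
o1's B-permissibility design ((D1′), p552583/p554842).
-/

noncomputable section

set_option linter.dupNamespace false -- mandated namespace of this single-conjunct summit

open CategoryTheory AlgebraicGeometry TopologicalSpace IsLocalRing
open Summit.ResolutionOfSingularities.ResolutionOfSingularities.Theorems.CampaignW42
open Literature.AlgebraicGeometry.Resolution Literature.RingTheory.HilbertSamuel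

namespace Summit.ResolutionOfSingularities.ResolutionOfSingularities.Theorems.SigmaMaxModificationsCorridor3.Sigma

universe u

open Scheme.IdealSheafData

/-! ## The list identity along the comparison morphism -/

section ListIdentity

variable {W D : Scheme.{u}} [IsLocallyNoetherian W] {ι : D ⟶ W} [IsClosedImmersion ι] {C : W.IdealSheafData} {E : Boundary W} {ζ : D}

omit [IsLocallyNoetherian W] in
/-- **MEMBER BY MEMBER**: for a coinciding member `B`, along the comparison `j : D̃ ⟶ Bl_C W` of the identity blow-up of `D̃` (the centre's trace `𝓟_ζ` is Cartier),
the transform `t B` restricts to the CURED trace: `(t B)|_{D̃} = cureMember ζ (B|_{D̃})` — `σᶜ(B,1)|_{D̃} = (B|_{D̃} : 𝓟_ζ)` on the member (CJS 4.8 (a)), `π^*B|_{D̃} = B|_{D̃}`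
off it. [folklore] -/
theorem comap_strictTransformHom_memberTransform_eq_cureMember [IsLocallyNoetherian (blowup C)]
    (hC : C = vanishingIdeal ⟨ι.base '' closure {ζ}, ι.isClosedEmbedding.isClosedMap _ isClosed_closure⟩) (hρ : IsBlowup (𝟙 D) (C.comap ι))
    {B : W.IdealSheafData} (hB : Boundary.MemberCoincides C B) :
    (Boundary.memberTransform C B).comap ((blowup.isBlowup C).strictTransformHom hρ) = cureMember ζ (B.comap ι) := by
  have hπ := blowup.isBlowup C
  have hsq := hπ.strictTransformHom_comp hρ
  have hCι : C.comap ι = primeDivisorIdeal ζ := by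
    rw [hC, primeDivisorIdeal]
    exact comap_vanishingIdeal_image_of_isClosedImmersion ι ⟨closure {ζ}, isClosed_closure⟩
  rw [(Boundary.memberCoincides_iff C B).mp hB]
  by_cases hBC : B ≤ C
  · -- on the member: `ζ ∈ supp (B|_D)` and the controlled transform restricts to the colon
    have hζB : ζ ∈ ((B.comap ι).support : Set D) := by
      have h1 : ζ ∈ ((C.comap ι).support : Set D) := by rw [hCι, SetLike.mem_coe, mem_support_primeDivisorIdeal_iff]
      exact Scheme.IdealSheafData.support_antitone (Scheme.IdealSheafData.comap_mono (f := ι) hBC) h1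
    rw [principalStrictTransform_of_le hBC, comap_strictTransformHom_controlledTransform hπ hρ (μ := 1) (by rwa [pow_one]), controlledTransform, pow_one,
      Scheme.IdealSheafData.comap_id, Scheme.IdealSheafData.comap_id, hCι, cureMember_of_mem hζB]
  · -- off the member: the total transform, and `ζ ∉ supp (B|_D)` (else `cl{ι ζ} ⊆ supp B`, i.e. `B ≤ C`)
    have hζB : ζ ∉ ((B.comap ι).support : Set D) := by
      intro h
      apply hBC
      rw [hC, ← Scheme.IdealSheafData.le_support_iff_le_vanishingIdeal]
      change ι.base '' closure {ζ} ⊆ (B.support : Set W)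
      rw [Boundary.coe_support_comap] at h
      have hcl : closure {ζ} ⊆ ι.base ⁻¹' (B.support : Set W) :=
        (B.support.isClosed.preimage ι.continuous).closure_subset_iff.mpr (Set.singleton_subset_iff.mpr h)
      rintro _ ⟨y, hy, rfl⟩
      exact hcl hy
    rw [principalStrictTransform_of_not_le hBC, ← Scheme.IdealSheafData.comap_comp, hsq, Category.id_comp, cureMember_of_not_mem hζB]

open scoped Classical in
/-- **THE LIST IDENTITY**: under coincidence, the filtered traces of `E.next C` along the comparison `j : D̃ ⟶ Bl_C W` ARE the cured list:
`(E.next C).restrictOff j = (E.restrictOff ι).cureAlong ζ` (old members in order, cured; the exceptional member last, restricting to `𝓟_ζ`; a member contains the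
next surface iff it contained the surface). [folklore] -/
theorem restrictOff_next_strictTransformHom_eq_cureAlong [IsLocallyNoetherian (blowup C)] [Nonempty D]
    (hC : C = vanishingIdeal ⟨ι.base '' closure {ζ}, ι.isClosedEmbedding.isClosedMap _ isClosed_closure⟩) (hρ : IsBlowup (𝟙 D) (C.comap ι))
    (hcoin : E.Coincides C) (hDd : Dense ((ι.base ⁻¹' (C.support : Set W))ᶜ : Set D)) :
    (E.next C).restrictOff ((blowup.isBlowup C).strictTransformHom hρ) = (E.restrictOff ι).cureAlong ζ := by
  have hπ := blowup.isBlowup C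
  have hsq := hπ.strictTransformHom_comp hρ
  set j := hπ.strictTransformHom hρ with hj
  have hCι : C.comap ι = primeDivisorIdeal ζ := by
    rw [hC, primeDivisorIdeal]
    exact comap_vanishingIdeal_image_of_isClosedImmersion ι ⟨closure {ζ}, isClosed_closure⟩
  have hlift : ∀ y : D, y ∉ ι.base ⁻¹' (C.support : Set W) → ∃ z : D, (𝟙 D : D ⟶ D).base z = y := fun y _ => ⟨y, rfl⟩
  have hZd : Dense (((𝟙 D : D ⟶ D).base ⁻¹' (ι.base ⁻¹' (C.support : Set W)))ᶜ : Set D) := hDd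
  unfold Boundary.restrictOff Boundary.cureAlong
  rw [Boundary.next_eq_map_memberTransform, List.filter_append, List.map_append]
  refine congrArg₂ (· ++ ·) ?_ ?_
  · rw [List.filter_map, List.map_map, List.map_map]
    refine List.filter_map_congr_aux E (cureMember ζ ∘ fun I => I.comap ι) ((fun I => I.comap j) ∘ Boundary.memberTransform C)
      (fun I => ¬ Set.range ι.base ⊆ (I.support : Set W)) ((fun I => ¬ Set.range j.base ⊆ (I.support : Set ↥(blowup C))) ∘ Boundary.memberTransform C)
      (fun B _ => ?_) (fun B hB _ => ?_)
    · simp only [Function.comp_apply]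
      exact not_congr (range_subset_support_iff_of_isSupportTransform_of_trace hsq rfl hlift hDd hZd (isSupportTransform_strictTransformIdeal C B))
    · simp only [Function.comp_apply]
      exact comap_strictTransformHom_memberTransform_eq_cureMember hC hρ (hcoin B hB)
  · have hkeep : ¬ Set.range j.base ⊆ ((C.comap (blowup.π C)).support : Set ↥(blowup C)) :=
      not_range_subset_support_exceptional_of_trace hsq rfl hlift hDd
    rw [List.filter_singleton]
    simp only [hkeep, not_false_eq_true, decide_true, cond_true, List.map_singleton]
    rw [comap_strictTransformHom_exceptional hπ hρ, Scheme.IdealSheafData.comap_id, hCι]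

end ListIdentity

/-! ## Run level: `M` at the cure step -/

section Run

variable {W : Scheme.{u}} [IsLocallyNoetherian W] {E : Boundary W} {D : Closeds W} {C : W.IdealSheafData}

/-- **`M(E.next C, D_next)` IS THE BADNESS OF THE CURED LIST** at a cure-curve step along a codimension-one point `ζ` of the configuration on the REGULAR reduced surface
of an irreducible `D`, under coincidence. [folklore] -/
theorem badOfRecord_next_eq_badness_cureAlong (hDirr : IsIrreducible (D : Set W)) (hreg : Scheme.IsRegular (menuCentre D).subscheme) (hcoin : E.Coincides C)
    {ζ : ↥(menuCentre D).subscheme} (hζ : Order.coheight ζ = 1)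
    (hC : C = vanishingIdeal ⟨(menuCentre D).subschemeι.base '' closure {ζ}, (menuCentre D).subschemeι.isClosedEmbedding.isClosedMap _ isClosed_closure⟩) :
    badOfRecord (blowup C) (E.next C) (surfaceNext (blowup.π C) C D) = ((E.restrictOff (menuCentre D).subschemeι).cureAlong ζ).badness := by
  haveI : IsProper (blowup.π C) := (blowup.isBlowup C).isProper
  haveI : IsLocallyNoetherian (blowup C) := LocallyOfFiniteType.isLocallyNoetherian (blowup.π C)
  set ι := (menuCentre D).subschemeι with hι
  haveI : IsIntegral (menuCentre D).subscheme := isIntegral_subscheme_vanishingIdeal D hDirr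
  haveI : IsLocallyNoetherian (menuCentre D).subscheme := LocallyOfFiniteType.isLocallyNoetherian ι
  haveI : Nonempty ↥(menuCentre D).subscheme := ⟨ζ⟩
  have hπ := blowup.isBlowup C
  have hCι : C.comap ι = primeDivisorIdeal ζ := by
    rw [hC, primeDivisorIdeal]
    exact comap_vanishingIdeal_image_of_isClosedImmersion ι ⟨closure {ζ}, isClosed_closure⟩
  have hcart : IsEffectiveCartier (C.comap ι) := by
    rw [hCι]; exact isEffectiveCartier_primeDivisorIdeal_of_isRegular hreg hζ
  have hρ : IsBlowup (𝟙 (menuCentre D).subscheme) (C.comap ι) := IsBlowup.id hcart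
  obtain ⟨e, he⟩ := exists_iso_menuCentre_surfaceNext (Z := D) hπ hρ
  -- density of the complement of the curve `cl{ζ}` in the irreducible surface
  have hDd : Dense ((ι.base ⁻¹' (C.support : Set W))ᶜ : Set ↥(menuCentre D).subscheme) := by
    rw [← Boundary.coe_support_comap, hCι, coe_support_primeDivisorIdeal]
    refine isClosed_closure.isOpen_compl.dense ⟨genericPoint ↥(menuCentre D).subscheme, fun hgen => ?_⟩
    rw [← specializes_iff_mem_closure] at hgen
    have heq : ζ = genericPoint ↥(menuCentre D).subscheme := (hgen.antisymm (genericPoint_specializes ζ)).eq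
    have h0 : Order.coheight (genericPoint ↥(menuCentre D).subscheme) = 0 := by
      rw [Order.coheight_eq_zero]
      intro y hy
      exact Scheme.le_iff_specializes.mpr (genericPoint_specializes y)
    rw [heq, h0] at hζ
    exact zero_ne_one hζ
  -- read `M` on the model `D̃` along `e`
  rw [badOfRecord_eq, ← Boundary.badness_restrict_of_iso e.hom, Boundary.restrict, Boundary.restrictOff_map_comap _ _ e.hom, he,
    restrictOff_next_strictTransformHom_eq_cureAlong hC hρ hcoin hDd]

/-- **`M` STRICTLY DROPS AT THE CURE-CURVE STEP OF THE RUN**: irreducible `D` with Noetherian regular reduced surface `D̃` of dimension `≤ 2`, the configuration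
`S(E, D)` snc (`ℓ(E, D) = 0`), coincidence, centre = the reduced curve `ι(cl{ζ})` on a BAD codimension-one point `ζ` of `S(E, D)` (`S_ζ ≥ 2`) ⇒
`M(E.next C, surfaceNext (blowup.π C) C D) < M(E, D)`. [folklore] -/
theorem badOfRecord_next_lt_of_cure [IsNoetherian (menuCentre D).subscheme] (hDirr : IsIrreducible (D : Set W)) (hreg : Scheme.IsRegular (menuCentre D).subscheme)
    (hdim : topologicalKrullDim ↥(menuCentre D).subscheme ≤ 2) (hS : IsStrictNormalCrossingsDivisor (menuCentre D).subscheme (surfaceTraceSet E D))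
    (hcoin : E.Coincides C) {ζ : ↥(menuCentre D).subscheme} (hζ : ζ ∈ (E.restrictOff (menuCentre D).subschemeι).codimOnePoints)
    (hbad : 2 ≤ ((E.restrictOff (menuCentre D).subschemeι).compMults ζ).sum)
    (hC : C = vanishingIdeal ⟨(menuCentre D).subschemeι.base '' closure {ζ}, (menuCentre D).subschemeι.isClosedEmbedding.isClosedMap _ isClosed_closure⟩) :
    badOfRecord (blowup C) (E.next C) (surfaceNext (blowup.π C) C D) < badOfRecord W E D := by
  haveI : IsIntegral (menuCentre D).subscheme := isIntegral_subscheme_vanishingIdeal D hDirr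
  rw [badOfRecord_next_eq_badness_cureAlong hDirr hreg hcoin hζ.2 hC, badOfRecord_eq]
  exact Boundary.badness_cureAlong_lt hreg (ne_bot_of_mem_restrictOff (E := E)) hS (coheight_le_two_of_topologicalKrullDim_le hdim) hζ hbad

/-- **… and never increases at a cure-curve step** (any codimension-one point of the snc configuration). [folklore] -/
theorem badOfRecord_next_le_of_cure [IsNoetherian (menuCentre D).subscheme] (hDirr : IsIrreducible (D : Set W)) (hreg : Scheme.IsRegular (menuCentre D).subscheme)
    (hdim : topologicalKrullDim ↥(menuCentre D).subscheme ≤ 2) (hS : IsStrictNormalCrossingsDivisor (menuCentre D).subscheme (surfaceTraceSet E D))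
    (hcoin : E.Coincides C) {ζ : ↥(menuCentre D).subscheme} (hζ : ζ ∈ (E.restrictOff (menuCentre D).subschemeι).codimOnePoints)
    (hC : C = vanishingIdeal ⟨(menuCentre D).subschemeι.base '' closure {ζ}, (menuCentre D).subschemeι.isClosedEmbedding.isClosedMap _ isClosed_closure⟩) :
    badOfRecord (blowup C) (E.next C) (surfaceNext (blowup.π C) C D) ≤ badOfRecord W E D := by
  haveI : IsIntegral (menuCentre D).subscheme := isIntegral_subscheme_vanishingIdeal D hDirr
  rw [badOfRecord_next_eq_badness_cureAlong hDirr hreg hcoin hζ.2 hC, badOfRecord_eq]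
  exact Boundary.badness_cureAlong_le hreg (ne_bot_of_mem_restrictOff (E := E)) hS (coheight_le_two_of_topologicalKrullDim_le hdim) hζ

end Run

end Summit.ResolutionOfSingularities.ResolutionOfSingularities.Theorems.SigmaMaxModificationsCorridor3.Sigma

end
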